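import Summits.BirchSwinnertonDyer.BirchSwinnertonDyer.Theorems.ResidualThetaTransportAtTwoSignedMuVanishingAtTwoPlusSel2
import Literature.NumberTheory.EllipticCurves.FineSelmerClassGroupCriterion
import Literature.NumberTheory.IwasawaTheory.ClassicalMuInvariant

/-!
# Line `universal-norm-line` — skeleton (planner crux-ideate k1g13; crux `SignedMuSeedAtTwoPlus`, stmt-BirchSwinnertonDyer-21438)

PUBLISHED with `ledger crux write … Lines/universal-norm-line.lean` ONLY (W-79: not registered with `skeleton check`; the line of
record on the parent crux stays `Cruxes/SignedMuVanishingAtTwoPlus/Lines/birth.lean`). BSD is not proved; the crux is not proved;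
this skeleton concludes the INSTANCE FAMILY `UnitLevelSeed` (habitat⁺ classes whose cubic field passes the unit-level test), not the
class-wide crux `SignedMuSeedAtTwoPlus` — the universal-norm line is a certificate / semi-decision engine (card §Transfer).

First checkable statements of the line, over existing declarations. Nothing is proved here; BSD is not proved by any of this.

* `NonFlatAtTwo L x` — the layer-0 local test at the prime `𝔮 ∣ 2` of the cubic field (`2𝓞_L = 𝔮³`): `v_𝔮(x − 1) = 1`.
  (Level computation in `L_𝔮 ≅ ℚ₂(∛2)`: the square classes of `ker N ⊂ L_𝔮ˣ/L_𝔮ˣ²` without a level-1 component are exactly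
  `{1, κ}`, `κ = [1 + 2∛4] = H¹_f(ℚ₂, W[2])` the flat (= plus = minus at layer 0) class, the same for every member by Honda.)
* `UnitLevelPlusLocal` (UNL₀) — odd class number rung: the universal-norm line of `H¹_ℒ(ℚ, W[2])` is spanned by `εu`, and
  `v_𝔮(εu − 1) = 1` forces the generic global line off both signed Lagrangians ⇒ plus-local half at every cyclotomic `κ`.
* `UnitLevelSeed` — the crux instance (with `A := W`) for those classes (UNL₀ + Iwasawa 1956 + (E1⇐) + `SplitFiniteness`).
* `NormLineAtOne` (UNL₁, the first even-class-number rung of the dimension criterion): if the norm projections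
  `N_{L₁/L}(y) / N_{L₁/ℚ}(y)` (`L₁ = L(√2)`, `y` running over `L₁(∅,2)`) span ONE square class `x ∈ Lˣ/Lˣ²` and `v_𝔮(x−1)=1`,
  then fine half AND plus-local half hold (`dim ⋂ₙ Iₙ = 1 + c₂`).
-/

set_option autoImplicit false
set_option linter.dupNamespace false

noncomputable section

open WeierstrassCurve Literature.NumberTheory.EllipticCurves
open Literature.NumberTheory.EllipticCurves.Kobayashi2003
open Literature.NumberTheory.EllipticCurves.Rank1Residual
open Literature.NumberTheory.IwasawaTheory
open Summit.BirchSwinnertonDyer.BirchSwinnertonDyer.Theses.ResidualThetaTransportAtTwo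

namespace Summit.BirchSwinnertonDyer.BirchSwinnertonDyer.Cruxes.SignedMuSeedAtTwoPlus.UniversalNormLine

/-- VERBATIM `FinePlusSplit.PlusLocalHalf` (restated: `Cruxes/…/Lines` modules are not library modules). -/
def PlusLocalHalf (A : WeierstrassCurve ℚ) [A.IsElliptic] (κ : ZpExtension ℚ 2) : Prop :=
  ((QuotientAddGroup.mk' (A.fineSelmerInfty κ)) ''
    {x : A.subgroupH1 2 κ.kerSubgroup | x ∈ signedSelmerInfty A κ 1 ∧ 2 • x = 0}).Finite

/-- VERBATIM `FinePlusSplit.FineMuZeroAtTwo` / `CubicMuExact.FineMuZeroAtTwo` (statement (A) of Coates–Sujatha at `(A,2)`). -/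
def FineMuZeroAtTwo (A : WeierstrassCurve ℚ) [A.IsElliptic] : Prop :=
  ∀ (κ : ZpExtension ℚ 2), κ.IsCyclotomic →
    ∃ (γ : Field.absoluteGaloisGroup ℚ) (D : A.FineSelmerDualData κ γ),
      Module.Finite ℤ_[2] (RestrictScalars ℤ_[2] (IwasawaAlgebra 2) D.X)

/-- VERBATIM `CubicMuExact.CubicFieldOf`: `L` is a cubic subfield of `ℚ(A[2])`. -/
def CubicFieldOf (A : WeierstrassCurve ℚ) [A.IsElliptic] (L : IntermediateField ℚ (AlgebraicClosure ℚ)) : Prop :=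
  L ≤ A.divisionField 2 ∧ Module.finrank ℚ L = 3

/-- The layer-0 local test at `𝔮 ∣ 2` (`2𝓞_L = 𝔮³`): `x ≡ 1 (mod 𝔮)` and `x ≢ 1 (mod 𝔮²)`, i.e. `v_𝔮(x − 1) = 1`. -/
def NonFlatAtTwo (L : IntermediateField ℚ (AlgebraicClosure ℚ)) (x : NumberField.RingOfIntegers L) : Prop :=
  ∃ 𝔮 : Ideal (NumberField.RingOfIntegers L), 𝔮.IsPrime ∧
    𝔮 ^ 3 = Ideal.span {(2 : NumberField.RingOfIntegers L)} ∧ x - 1 ∈ 𝔮 ∧ x - 1 ∉ 𝔮 ^ 2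

/-- `u` is a fundamental unit of the (unit rank one) field `L`: every unit is `ζ · u^k` with `ζ` torsion. -/
def IsFundamentalUnit (L : IntermediateField ℚ (AlgebraicClosure ℚ)) (u : (NumberField.RingOfIntegers L)ˣ) : Prop :=
  ∀ v : (NumberField.RingOfIntegers L)ˣ, ∃ (k : ℤ) (ζ : (NumberField.RingOfIntegers L)ˣ),
    ζ ∈ NumberField.Units.torsion L ∧ v = ζ * u ^ k

/-- `εu := N(u) · u` (so that `N_{L/ℚ}(εu) = N(u)² = 1`: the Kummer class of `εu` lies in `ker N = H¹(ℚ, W[2])`). -/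
def normTimesUnit (L : IntermediateField ℚ (AlgebraicClosure ℚ)) (u : (NumberField.RingOfIntegers L)ˣ) :
    NumberField.RingOfIntegers L :=
  ((Algebra.norm ℤ (u : NumberField.RingOfIntegers L) : ℤ) : NumberField.RingOfIntegers L) *
    (u : NumberField.RingOfIntegers L)

/-- **UNL₀ (First lemma; odd class number rung of the universal-norm line).** For a habitat⁺ curve `W` with cubic field
`L ⊂ ℚ(W[2])` of ODD class number and fundamental unit `u`: `v_𝔮(εu − 1) = 1` ⇒ the plus-local half at every cyclotomic `κ`.
(Route: `h` odd ⇒ `H¹_ℒ(ℚ, W[2]) = ⟨[εu]⟩` is the universal-norm line `U` (dim `U = 1 + c₂ = 1`); `loc_𝔮[εu] ∉ H¹_f ⊇ 𝒫^± mod T`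
⇒ generic global line `𝒢 ⊄ 𝒫⁺` ⇒ `Sel⁺[2]/Sel₀` finite. The same hypothesis gives the minus sign.) -/
def UnitLevelPlusLocal : Prop :=
  ∀ (W : WeierstrassCurve ℚ) [W.IsElliptic] [W.IsGloballyMinimal], ¬ W.HasCM → W.analyticRank = 0 →
    GoodSS W 2 → W.frobeniusTrace 2 = 0 → W.Δ < 0 →
    ∀ (L : IntermediateField ℚ (AlgebraicClosure ℚ)) [NumberField L], CubicFieldOf W L → Odd (NumberField.classNumber L) →
    ∀ (u : (NumberField.RingOfIntegers L)ˣ), IsFundamentalUnit L u → NonFlatAtTwo L (normTimesUnit L u) →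
    ∀ (κ : ZpExtension ℚ 2), κ.IsCyclotomic → PlusLocalHalf W κ

/-- **UNL₀ ⇒ the crux instance** (with `A := W`) for every habitat⁺ curve whose class passes the unit-level test: composition of
`UnitLevelPlusLocal` with «`h(L)` odd ⇒ `μ₂(L^cyc) = 0`» (Iwasawa 1956), (E1⇐) `FineHalfOfCubicMu` and `SplitFiniteness` (p. landed). -/
def UnitLevelSeed : Prop :=
  ∀ (W : WeierstrassCurve ℚ) [W.IsElliptic] [W.IsGloballyMinimal], ¬ W.HasCM → W.analyticRank = 0 →
    GoodSS W 2 → W.frobeniusTrace 2 = 0 → W.Δ < 0 →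
    ∀ (L : IntermediateField ℚ (AlgebraicClosure ℚ)) [NumberField L], CubicFieldOf W L → Odd (NumberField.classNumber L) →
    ∀ (u : (NumberField.RingOfIntegers L)ˣ), IsFundamentalUnit L u → NonFlatAtTwo L (normTimesUnit L u) →
    ∀ (κ : ZpExtension ℚ 2) (γ : Field.absoluteGaloisGroup ℚ), κ.IsCyclotomic → κ.IsTopGenerator γ →
      ∀ (D : SignedSelmerDualData W κ γ 1) [Module.Finite (IwasawaAlgebra 2) D.X],
        Module.IsTorsion (IwasawaAlgebra 2) D.X ∧ D.mu = 0

/-- The first cyclotomic layer `L₁ = L(√2) = L·ℚ₁` as an intermediate field OVER `L` (so that `Algebra.norm L` is the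
relative norm `N_{L₁/L}`); `s` is a chosen square root of `2` in the algebraic closure. -/
def layerOne (L : IntermediateField ℚ (AlgebraicClosure ℚ)) (s : AlgebraicClosure ℚ) :
    IntermediateField L (AlgebraicClosure ℚ) :=
  IntermediateField.extendScalars (F := L) (E := L ⊔ IntermediateField.adjoin ℚ {s}) le_sup_left

/-- The norm projection (corestriction on the `W[2]`-isotypic part of Kummer theory):
`x(y) = N_{L₁/L}(y) / N_{L₁/ℚ}(y) ∈ L` (note `N_{L₁/ℚ} = N_{L/ℚ} ∘ N_{L₁/L}`). -/
def normProjection (L : IntermediateField ℚ (AlgebraicClosure ℚ)) (s : AlgebraicClosure ℚ) (y : layerOne L s) : L :=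
  Algebra.norm L y / algebraMap ℚ L (Algebra.norm ℚ (Algebra.norm L y))

/-- **UNL₁ (first even-class-number rung of the DIMENSION CRITERION `dim ⋂ₙ Iₙ = 1 + c₂`).** If the norm projections of the
nonzero integral `y ∈ L₁ = L(√2)` generating SQUARE ideals (a generating set of `L₁(∅,2)`, i.e. of `H¹_ℒ(ℚ₁, W[2]) ⊕ (ℚ₁-part)`)
all fall into the two square classes `{1, [x₀]}` of `L` for one non-square `x₀` with `v_𝔮(x₀ − 1) = 1`, then `dim I₁ ≤ 1`, hence
(`dim I₁ ≥ 1 + c₂` always) `c₂ = 0` — the fine half — and `[x₀]` is the universal-norm class, non-flat at `𝔮` — the plus-local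
half at every cyclotomic `κ` (and the minus one). -/
def NormLineAtOne : Prop :=
  ∀ (W : WeierstrassCurve ℚ) [W.IsElliptic] [W.IsGloballyMinimal], ¬ W.HasCM → W.analyticRank = 0 →
    GoodSS W 2 → W.frobeniusTrace 2 = 0 → W.Δ < 0 →
    ∀ (L : IntermediateField ℚ (AlgebraicClosure ℚ)), CubicFieldOf W L →
    ∀ (s : AlgebraicClosure ℚ), s ^ 2 = 2 →
    ∀ (x₀ : NumberField.RingOfIntegers L), NonFlatAtTwo L x₀ → ¬ IsSquare (x₀ : L) →
      (∀ y : NumberField.RingOfIntegers (layerOne L s), y ≠ 0 →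
        (∃ I : Ideal (NumberField.RingOfIntegers (layerOne L s)), Ideal.span {y} = I ^ 2) →
        IsSquare (normProjection L s y) ∨ IsSquare (normProjection L s y * (x₀ : L)⁻¹)) →
      FineMuZeroAtTwo W ∧ ∀ (κ : ZpExtension ℚ 2), κ.IsCyclotomic → PlusLocalHalf W κ

/-- **Support (Iwasawa 1956 + E1⇐).** `h(L)` odd, `𝔮` the unique (totally ramified) prime of `L_n` over `2` ⇒ `2 ∤ h(L_n)` for
all `n` ⇒ `μ₂(L^cyc) = 0` ⇒ (E1⇐, `CubicMuExact.fineMuZeroAtTwo_of_cubicMu`) the fine half for every member. -/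
def FineOfOddClassNumber : Prop :=
  ∀ (W : WeierstrassCurve ℚ) [W.IsElliptic] [W.IsGloballyMinimal], ¬ W.HasCM → W.analyticRank = 0 →
    GoodSS W 2 → W.frobeniusTrace 2 = 0 → W.Δ < 0 →
    ∀ (L : IntermediateField ℚ (AlgebraicClosure ℚ)) [NumberField L], CubicFieldOf W L → Odd (NumberField.classNumber L) →
    FineMuZeroAtTwo W

/-- **Support (tree glue).** fine half ∧ plus-local half at every cyclotomic `κ` ⇒ the seed conclusion for `A` itself
(`FineSplit.splitFiniteness` = `Sel⁺[2]` finite, then the `Sel2` door `finite Sel⁺[2] ⇒ X⁺ torsion ∧ μ⁺ = 0`). -/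
def HalvesGiveSeed : Prop :=
  ∀ (A : WeierstrassCurve ℚ) [A.IsElliptic], FineMuZeroAtTwo A → (∀ (κ : ZpExtension ℚ 2), κ.IsCyclotomic → PlusLocalHalf A κ) →
    ∀ (κ : ZpExtension ℚ 2) (γ : Field.absoluteGaloisGroup ℚ), κ.IsCyclotomic → κ.IsTopGenerator γ →
      ∀ (D : SignedSelmerDualData A κ γ 1) [Module.Finite (IwasawaAlgebra 2) D.X],
        Module.IsTorsion (IwasawaAlgebra 2) D.X ∧ D.mu = 0

/-! ## Stubs (sorried; NOT registered) and the kernel-checked composition -/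

/-- Stub 1 (LOAD-BEARING, size M–L): UNL₀ — freeness of `H¹_{Iw,ℒ}(ℚ, W[2])` (rank `1 + c₂`), perfect control, identification of
the universal-norm line with `⟨[εu]⟩` when `h(L)` is odd, `cores₀(𝒫^±) ⊆ H¹_f(ℚ₂, W[2]) = {0, κ}` (Honda + `E(ℚ₂) ⊂ E^±`), and
Poitou–Tate: `PlusLocalHalf W κ ⟺ 𝒢^{sat} ≠ 𝒫⁺`. -/
theorem stub_unitLevelPlusLocal : UnitLevelPlusLocal := by
  sorry

/-- Stub 2 (support, size S–M): Iwasawa 1956 for `L^cyc/L` + (E1⇐). -/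
theorem stub_fineOfOddClassNumber : FineOfOddClassNumber := by
  sorry

/-- Stub 3 (support, size S): `splitFiniteness` + the `Sel2` door, by name. -/
theorem stub_halvesGiveSeed : HalvesGiveSeed := by
  sorry

/-- Stub 4 (size M–L): UNL₁ — the first rung of the dimension criterion `dim ⋂ₙ Iₙ = 1 + c₂` (even class number). -/
theorem stub_normLineAtOne : NormLineAtOne := by
  sorry

/-- **Composition (no sorry of its own):** UNL₀ + Iwasawa 1956/E1 + tree glue ⇒ the crux instance with `A := W` for every
habitat⁺ curve whose cubic field has odd class number and a non-flat fundamental unit (`v_𝔮(εu − 1) = 1`; 280 of the 418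
odd-class-number habitat-type cubic fields with `|d_L| ≤ 2·10⁴`, kit job j311963). -/
theorem unitLevelSeed_of (h₁ : UnitLevelPlusLocal) (h₂ : FineOfOddClassNumber) (h₃ : HalvesGiveSeed) : UnitLevelSeed := by
  intro W _ _ hCM hr hss ha hΔ L _ hL hodd u hu hnf κ γ hκ hγ D _
  exact h₃ W (h₂ W hCM hr hss ha hΔ L hL hodd) (fun κ' hκ' => h₁ W hCM hr hss ha hΔ L hL hodd u hu hnf κ' hκ') κ γ hκ hγ D

theorem unitLevelSeed : UnitLevelSeed :=
  unitLevelSeed_of stub_unitLevelPlusLocal stub_fineOfOddClassNumber stub_halvesGiveSeed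

end Summit.BirchSwinnertonDyer.BirchSwinnertonDyer.Cruxes.SignedMuSeedAtTwoPlus.UniversalNormLine
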